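import Summits.Ventures.QEC.Census.CertCheckMitm
import Summits.Ventures.QEC.Decoders.RadiusCheck
import HarnessLib

/-!
# Ventures/QEC — Decoders/RadiusCheckTree: tree-keyed table decoders, and «a meet-in-the-middle distance
# certificate is a certified bounded-distance decoder» (qec PARTITION row 08; continuation of `RadiusCheck.lean`)

HONEST FRAMING: CERTIFIED column only; nothing probabilistic; no code parameter asserted. Same vocabulary as
`Decoders/RadiusCheck.lean` (`Decoder.CorrectsUpTo` of `Literature/…/SyndromeDecoding{,CSS}.lean`, word layer of
`Census/CertBits.lean` + `Census/CertScan.lean`), with the table keyed by a binary-search-tree literal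
`Census.SynTree` (`Census/CertCheckMitm.lean`, qec-search-9) instead of an association list: a lookup costs the
tree depth (`≈ log₂ |table|` comparisons) instead of `|table|/2`, which is what makes kernel (`decide`) radius
certificates of `10³–10⁵`-entry tables light. As in `CertCheckMitm`, NO property of the tree (ordering, balance) is
used by the soundness theorems — `SynTree.find` is an arbitrary function `ℕ → Option ℕ`.

* `treeDecoder n m T` — the decoder `(Fin m → ZMod 2) → (Fin n → ZMod 2)`: key the syndrome by its numeral, answer
  `T.find`, trivial correction on a miss (tree form of `tableDecoder` / `Decoder.ofTable`).
* ROUTE I (identity residual) with the leaf test `Census.tableTest T v s := (T.find s == some v)` — literally the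
  (T1) component of the meet-in-the-middle replay `Census.mitmLowerOK`: `checkRadiusTreeI`, chunks
  `radiusChunkTreeI` (CERT-FORMAT §7 chunk key = smallest support index, `Census.reaches_of_chunks`), soundness
  `correctsUpToX/Z_of_checkRadiusTreeI`, `…_of_radiusChunksTreeI`, and from any complete replay
  `correctsUpToX_of_reachesTreeI`.
* ROUTE E (explicit residual certificates, for degenerate-regime decoders such as MWPM: residual = a product of
  checks) with both tables as trees, the residual certificate of an error word being a BITMASK of stabilizer rows
  (`maskSel`): `leafTreeE` / `checkRadiusTreeE` / `radiusChunkTreeE`, soundness `correctsUpToX/Z_of_checkRadiusTreeE`,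
  `…_of_radiusChunksTreeE` — no distance hypothesis.
* EXACTNESS one weight up: `checkFailTreeX` + `not_correctsUpToX_of_checkFailTreeX` (tree form of `checkFailX`).
* **MITM ⇒ RADIUS** (`DistCertRadius.correctsUpToX_of_mitmX`, `correctsUpToZ_of_mitmZ`): a passed meet-in-the-middle
  lower-bound replay `c.mitmX wa wb pos T = true` of a distance certificate `c` CONTAINS (T1) «every `X`-pattern of
  weight `≤ wb` is filed in `T` under its own `H^Z`-syndrome», hence the shipped table `T`, read as a decoder, returns
  every `X`-error of weight `≤ wb` verbatim: `treeDecoder c.n |c.HZ| T` corrects every `X`-error of weight `≤ wb` on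
  `c.code` — the syndrome-table (bounded-distance) decoder of Ryan–Lin–Wilson §3.1.4 ("table-look-up decoding"),
  certified at ZERO extra kernel cost for every code whose distance row is closed by `mitm`. For `[[72,12,6]]`
  (`wb = 2 = ⌊(6−1)/2⌋`) this is the full correction radius; instance file `Decoders/BB72SyndromeTable.lean`.

Sources of the statements: the decoding vocabulary files (Nielsen–Chuang §10.5.5, Ryan–Lin–Wilson §3.1.4,
Delfosse–Nickerson §3); CERT-FORMAT v1 §5.2 (mitm table).
-/

namespace Summit.Ventures.QEC.Decoders

open Matrix Literature.InformationTheory.QuantumCodes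

/-! ## The tree-keyed table decoder -/

/-- The **tree-keyed table decoder on words**: key the syndrome `σ : Fin m → ZMod 2` by its numeral, look it up in
the tree `T` (key = syndrome word, value = correction word), return the correction word as a vector; a miss gets the
trivial correction (word `0`). Tree form of `tableDecoder`. (definition; `noncomputable` like `SynTree.find` —
evaluated by `decide +kernel`, never compiled) -/
noncomputable def treeDecoder (n m : ℕ) (T : Census.SynTree) : Decoder (Fin m → ZMod 2) (Fin n → ZMod 2) :=
  fun σ => Census.ofBits n ((T.find (toBits σ)).getD 0)

/-- The tree decoder on a true syndrome `H e` answers with the word stored under the syndrome word of `e`'s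
support list. -/
theorem treeDecoder_mulVec (n : ℕ) (H : List ℕ) (T : Census.SynTree) (e : Fin n → ZMod 2) :
    treeDecoder n H.length T (Census.rowMatrix n H *ᵥ e) =
      Census.ofBits n ((T.find (Census.xorSnd (Census.suppList n H e))).getD 0) := by
  rw [treeDecoder, toBits_mulVec_eq_xorSnd]

/-! ## Route I on trees: the table answer is the error itself -/

/-- **Route-I radius check, tree form**: every word of weight `≤ t` on `n` qubits is filed in `T` under its own
`Hsyn`-syndrome word (leaf test `Census.tableTest T v s = (T.find s == some v)`, the (T1) test of the
meet-in-the-middle replay). (definition) -/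
noncomputable def checkRadiusTreeI (n : ℕ) (Hsyn : List ℕ) (T : Census.SynTree) (t : ℕ) : Bool :=
  Census.scan (Census.tableTest T) (Census.posList n Hsyn) t 0 0

/-- Chunk `i` of the route-I tree replay with total budget `b + 1`: the supports whose smallest qubit is `i`.
(definition) -/
noncomputable def radiusChunkTreeI (n : ℕ) (Hsyn : List ℕ) (T : Census.SynTree) (b i : ℕ) : Bool :=
  Census.scan (Census.tableTest T) ((Census.posList n Hsyn).drop (i + 1)) b (2 ^ i) (Census.colMask Hsyn i)

/-- **Route I from any complete replay, tree form**: if `tableTest T` was reached on every support of weight `≤ t`,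
the residual of every error of weight `≤ t` under the tree decoder is `0`. (theorem) -/
theorem residual_eq_zero_of_reachesTreeI {n : ℕ} {Hsyn : List ℕ} {T : Census.SynTree} {t : ℕ}
    (h : Census.Reaches (Census.tableTest T) (Census.posList n Hsyn) t 0 0) (e : Fin n → ZMod 2)
    (he : hammingNorm e ≤ t) :
    treeDecoder n Hsyn.length T (Census.rowMatrix n Hsyn *ᵥ e) + e = 0 := by
  have hS := h (Census.suppList n Hsyn e) (Census.suppList_sublist n Hsyn e)
    (by rw [Census.length_suppList]; exact he)
  rw [Nat.zero_xor, Nat.zero_xor, Census.tableTest, beq_iff_eq] at hS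
  rw [treeDecoder_mulVec, hS, Option.getD_some, Census.ofBits_xorFst_suppList]
  funext i
  exact CharTwo.add_self_eq_zero _

/-- **Assembling the route-I tree chunks**: the empty-word leaf plus the `n` first-index chunks of budget `b` give
the complete replay of budget `b + 1`. (theorem) -/
theorem reachesTreeI_of_chunks {n : ℕ} {Hsyn : List ℕ} {T : Census.SynTree} {b : ℕ}
    (h0 : Census.tableTest T 0 0 = true) (h : ∀ i : ℕ, i < n → radiusChunkTreeI n Hsyn T b i = true) :
    Census.Reaches (Census.tableTest T) (Census.posList n Hsyn) (b + 1) 0 0 := by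
  refine Census.reaches_of_chunks _ b 0 0 h0 fun i hi => ?_
  have hin : i < n := by simpa [Census.posList] using hi
  have hget : (Census.posList n Hsyn)[i] = (2 ^ i, Census.colMask Hsyn i) := by simp [Census.posList]
  rw [hget, Nat.zero_xor, Nat.zero_xor]
  exact Census.reaches_of_scan (h i hin)

/-- Route I, `X`-sector, tree form, from a complete replay over the `Z`-rows: the tree decoder corrects every
`X`-error of weight `≤ t` (residual `0 ∈ rs H^X`); no distance hypothesis. (theorem) -/
theorem correctsUpToX_of_reachesTreeI {n : ℕ} {HX HZ : List ℕ}
    (hcomm : Census.rowMatrix n HX * (Census.rowMatrix n HZ)ᵀ = 0) {T : Census.SynTree} {t : ℕ}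
    (h : Census.Reaches (Census.tableTest T) (Census.posList n HZ) t 0 0) :
    (treeDecoder n HZ.length T).CorrectsUpTo
      (CSSCode.ofMatrices (Census.rowMatrix n HX) (Census.rowMatrix n HZ) hcomm).xSyndrome
      ((CSSCode.ofMatrices (Census.rowMatrix n HX) (Census.rowMatrix n HZ) hcomm).rowSpX :
        Set (Fin n → ZMod 2)) hammingNorm t := by
  intro e he
  rw [Decoder.corrects_iff, SetLike.mem_coe, CSSCode.xSyndrome_apply]
  have h0 := residual_eq_zero_of_reachesTreeI h e he
  rw [show (CSSCode.ofMatrices (Census.rowMatrix n HX) (Census.rowMatrix n HZ) hcomm).HZ =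
      Census.rowMatrix n HZ from rfl, h0]
  exact Submodule.zero_mem _

/-- **Soundness of route I (`X`-sector), tree form, one scan**: a passed `checkRadiusTreeI n HZ T t` gives: the tree
decoder corrects every `X`-error of weight `≤ t`. (theorem) -/
theorem correctsUpToX_of_checkRadiusTreeI {n : ℕ} {HX HZ : List ℕ}
    (hcomm : Census.rowMatrix n HX * (Census.rowMatrix n HZ)ᵀ = 0) {T : Census.SynTree} {t : ℕ}
    (h : checkRadiusTreeI n HZ T t = true) :
    (treeDecoder n HZ.length T).CorrectsUpTo
      (CSSCode.ofMatrices (Census.rowMatrix n HX) (Census.rowMatrix n HZ) hcomm).xSyndrome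
      ((CSSCode.ofMatrices (Census.rowMatrix n HX) (Census.rowMatrix n HZ) hcomm).rowSpX :
        Set (Fin n → ZMod 2)) hammingNorm t :=
  correctsUpToX_of_reachesTreeI hcomm (Census.reaches_of_scan h)

/-- **Soundness of route I (`Z`-sector), tree form, one scan** (rows exchanged: `checkRadiusTreeI n HX T t`).
(theorem) -/
theorem correctsUpToZ_of_checkRadiusTreeI {n : ℕ} {HX HZ : List ℕ}
    (hcomm : Census.rowMatrix n HX * (Census.rowMatrix n HZ)ᵀ = 0) {T : Census.SynTree} {t : ℕ}
    (h : checkRadiusTreeI n HX T t = true) :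
    (treeDecoder n HX.length T).CorrectsUpTo
      (CSSCode.ofMatrices (Census.rowMatrix n HX) (Census.rowMatrix n HZ) hcomm).zSyndrome
      ((CSSCode.ofMatrices (Census.rowMatrix n HX) (Census.rowMatrix n HZ) hcomm).rowSpZ :
        Set (Fin n → ZMod 2)) hammingNorm t :=
  correctsUpToX_of_checkRadiusTreeI
    (CSSCode.ofMatrices (Census.rowMatrix n HX) (Census.rowMatrix n HZ) hcomm).swap.comm h

/-- **Soundness of route I (`X`-sector), tree form, chunked** (empty-word leaf + `n` chunks of budget `b` ⟹ radius
`b + 1`). (theorem) -/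
theorem correctsUpToX_of_radiusChunksTreeI {n : ℕ} {HX HZ : List ℕ}
    (hcomm : Census.rowMatrix n HX * (Census.rowMatrix n HZ)ᵀ = 0) {T : Census.SynTree} {b : ℕ}
    (h0 : Census.tableTest T 0 0 = true) (h : ∀ i : ℕ, i < n → radiusChunkTreeI n HZ T b i = true) :
    (treeDecoder n HZ.length T).CorrectsUpTo
      (CSSCode.ofMatrices (Census.rowMatrix n HX) (Census.rowMatrix n HZ) hcomm).xSyndrome
      ((CSSCode.ofMatrices (Census.rowMatrix n HX) (Census.rowMatrix n HZ) hcomm).rowSpX :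
        Set (Fin n → ZMod 2)) hammingNorm (b + 1) :=
  correctsUpToX_of_reachesTreeI hcomm (reachesTreeI_of_chunks h0 h)

/-- **Soundness of route I (`Z`-sector), tree form, chunked.** (theorem) -/
theorem correctsUpToZ_of_radiusChunksTreeI {n : ℕ} {HX HZ : List ℕ}
    (hcomm : Census.rowMatrix n HX * (Census.rowMatrix n HZ)ᵀ = 0) {T : Census.SynTree} {b : ℕ}
    (h0 : Census.tableTest T 0 0 = true) (h : ∀ i : ℕ, i < n → radiusChunkTreeI n HX T b i = true) :
    (treeDecoder n HX.length T).CorrectsUpTo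
      (CSSCode.ofMatrices (Census.rowMatrix n HX) (Census.rowMatrix n HZ) hcomm).zSyndrome
      ((CSSCode.ofMatrices (Census.rowMatrix n HX) (Census.rowMatrix n HZ) hcomm).rowSpZ :
        Set (Fin n → ZMod 2)) hammingNorm (b + 1) :=
  correctsUpToX_of_radiusChunksTreeI
    (CSSCode.ofMatrices (Census.rowMatrix n HX) (Census.rowMatrix n HZ) hcomm).swap.comm h0 h

/-! ## Route E on trees: explicit residual certificates -/

/-- Row selection from a bitmask: the indices `r < m` whose bit is set in `mask`, ascending. (definition) -/
def maskSel (m mask : ℕ) : List ℕ := (List.range m).filter fun r => mask.testBit r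

/-- Leaf test of route E, tree form, at (error word `v`, syndrome word `s`): the certificate tree `E` files under `v`
a BITMASK of stabilizer rows (bit `r` = row `r` of `Hstab`) whose XOR is the residual `T(s) ⊕ v`. (definition) -/
noncomputable def leafTreeE (n : ℕ) (Hstab : List ℕ) (T E : Census.SynTree) (v s : ℕ) : Bool :=
  match E.find v with
  | none => false
  | some mask => Census.xorRows Hstab (maskSel Hstab.length mask) == (((T.find s).getD 0) ^^^ v) && (v < 2 ^ n : Bool)

/-- **Route-E radius check, tree form**: every word of weight `≤ t`, with its true `Hsyn`-syndrome, passes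
`leafTreeE` against the stabilizer rows `Hstab`. (definition) -/
noncomputable def checkRadiusTreeE (n : ℕ) (Hsyn Hstab : List ℕ) (T E : Census.SynTree) (t : ℕ) : Bool :=
  Census.scan (leafTreeE n Hstab T E) (Census.posList n Hsyn) t 0 0

/-- Chunk `i` of the route-E tree replay with total budget `b + 1`. (definition) -/
noncomputable def radiusChunkTreeE (n : ℕ) (Hsyn Hstab : List ℕ) (T E : Census.SynTree) (b i : ℕ) : Bool :=
  Census.scan (leafTreeE n Hstab T E) ((Census.posList n Hsyn).drop (i + 1)) b (2 ^ i) (Census.colMask Hsyn i)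

/-- **Route E from any complete replay, tree form**: the residual of every error of weight `≤ t` under the tree
decoder lies in the row space of the stabilizer rows. (theorem) -/
theorem residual_mem_of_reachesTreeE {n : ℕ} {Hsyn Hstab : List ℕ} {T E : Census.SynTree} {t : ℕ}
    (h : Census.Reaches (leafTreeE n Hstab T E) (Census.posList n Hsyn) t 0 0) (e : Fin n → ZMod 2)
    (he : hammingNorm e ≤ t) :
    treeDecoder n Hsyn.length T (Census.rowMatrix n Hsyn *ᵥ e) + e ∈
      rowSpace (Census.rowMatrix n Hstab) := by
  have hS := h (Census.suppList n Hsyn e) (Census.suppList_sublist n Hsyn e)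
    (by rw [Census.length_suppList]; exact he)
  rw [Nat.zero_xor, Nat.zero_xor, leafTreeE] at hS
  cases hl : E.find (Census.xorFst (Census.suppList n Hsyn e)) with
  | none => rw [hl] at hS; exact Bool.noConfusion hS
  | some mask =>
    rw [hl] at hS
    simp only [Bool.and_eq_true, beq_iff_eq, decide_eq_true_eq] at hS
    have key := Census.ofBits_xorRows_mem_rowSpace n Hstab (maskSel Hstab.length mask)
    rw [hS.1, Census.ofBits_xor, Census.ofBits_xorFst_suppList] at key
    rw [treeDecoder_mulVec]
    exact key

/-- **Assembling the route-E tree chunks.** (theorem) -/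
theorem reachesTreeE_of_chunks {n : ℕ} {Hsyn Hstab : List ℕ} {T E : Census.SynTree} {b : ℕ}
    (h0 : leafTreeE n Hstab T E 0 0 = true)
    (h : ∀ i : ℕ, i < n → radiusChunkTreeE n Hsyn Hstab T E b i = true) :
    Census.Reaches (leafTreeE n Hstab T E) (Census.posList n Hsyn) (b + 1) 0 0 := by
  refine Census.reaches_of_chunks _ b 0 0 h0 fun i hi => ?_
  have hin : i < n := by simpa [Census.posList] using hi
  have hget : (Census.posList n Hsyn)[i] = (2 ^ i, Census.colMask Hsyn i) := by simp [Census.posList]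
  rw [hget, Nat.zero_xor, Nat.zero_xor]
  exact Census.reaches_of_scan (h i hin)

/-- Route E, `X`-sector, tree form, from a complete replay over the `Z`-rows (no distance hypothesis). (theorem) -/
theorem correctsUpToX_of_reachesTreeE {n : ℕ} {HX HZ : List ℕ}
    (hcomm : Census.rowMatrix n HX * (Census.rowMatrix n HZ)ᵀ = 0) {T E : Census.SynTree} {t : ℕ}
    (h : Census.Reaches (leafTreeE n HX T E) (Census.posList n HZ) t 0 0) :
    (treeDecoder n HZ.length T).CorrectsUpTo
      (CSSCode.ofMatrices (Census.rowMatrix n HX) (Census.rowMatrix n HZ) hcomm).xSyndrome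
      ((CSSCode.ofMatrices (Census.rowMatrix n HX) (Census.rowMatrix n HZ) hcomm).rowSpX :
        Set (Fin n → ZMod 2)) hammingNorm t :=
  fun e he => residual_mem_of_reachesTreeE h e he

/-- **Soundness of route E (`X`-sector), tree form, one scan**: a passed `checkRadiusTreeE n HZ HX T E t`
gives: the tree decoder corrects every `X`-error of weight `≤ t`. (theorem) -/
theorem correctsUpToX_of_checkRadiusTreeE {n : ℕ} {HX HZ : List ℕ}
    (hcomm : Census.rowMatrix n HX * (Census.rowMatrix n HZ)ᵀ = 0) {T E : Census.SynTree} {t : ℕ}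
    (h : checkRadiusTreeE n HZ HX T E t = true) :
    (treeDecoder n HZ.length T).CorrectsUpTo
      (CSSCode.ofMatrices (Census.rowMatrix n HX) (Census.rowMatrix n HZ) hcomm).xSyndrome
      ((CSSCode.ofMatrices (Census.rowMatrix n HX) (Census.rowMatrix n HZ) hcomm).rowSpX :
        Set (Fin n → ZMod 2)) hammingNorm t :=
  correctsUpToX_of_reachesTreeE hcomm (Census.reaches_of_scan h)

/-- **Soundness of route E (`Z`-sector), tree form, one scan** (rows exchanged: `checkRadiusTreeE n HX HZ T E t`).
(theorem) -/
theorem correctsUpToZ_of_checkRadiusTreeE {n : ℕ} {HX HZ : List ℕ}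
    (hcomm : Census.rowMatrix n HX * (Census.rowMatrix n HZ)ᵀ = 0) {T E : Census.SynTree} {t : ℕ}
    (h : checkRadiusTreeE n HX HZ T E t = true) :
    (treeDecoder n HX.length T).CorrectsUpTo
      (CSSCode.ofMatrices (Census.rowMatrix n HX) (Census.rowMatrix n HZ) hcomm).zSyndrome
      ((CSSCode.ofMatrices (Census.rowMatrix n HX) (Census.rowMatrix n HZ) hcomm).rowSpZ :
        Set (Fin n → ZMod 2)) hammingNorm t :=
  correctsUpToX_of_checkRadiusTreeE
    (CSSCode.ofMatrices (Census.rowMatrix n HX) (Census.rowMatrix n HZ) hcomm).swap.comm h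

/-- **Soundness of route E (`X`-sector), tree form, chunked.** (theorem) -/
theorem correctsUpToX_of_radiusChunksTreeE {n : ℕ} {HX HZ : List ℕ}
    (hcomm : Census.rowMatrix n HX * (Census.rowMatrix n HZ)ᵀ = 0) {T E : Census.SynTree} {b : ℕ}
    (h0 : leafTreeE n HX T E 0 0 = true)
    (h : ∀ i : ℕ, i < n → radiusChunkTreeE n HZ HX T E b i = true) :
    (treeDecoder n HZ.length T).CorrectsUpTo
      (CSSCode.ofMatrices (Census.rowMatrix n HX) (Census.rowMatrix n HZ) hcomm).xSyndrome
      ((CSSCode.ofMatrices (Census.rowMatrix n HX) (Census.rowMatrix n HZ) hcomm).rowSpX :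
        Set (Fin n → ZMod 2)) hammingNorm (b + 1) :=
  correctsUpToX_of_reachesTreeE hcomm (reachesTreeE_of_chunks h0 h)

/-- **Soundness of route E (`Z`-sector), tree form, chunked.** (theorem) -/
theorem correctsUpToZ_of_radiusChunksTreeE {n : ℕ} {HX HZ : List ℕ}
    (hcomm : Census.rowMatrix n HX * (Census.rowMatrix n HZ)ᵀ = 0) {T E : Census.SynTree} {b : ℕ}
    (h0 : leafTreeE n HZ T E 0 0 = true)
    (h : ∀ i : ℕ, i < n → radiusChunkTreeE n HX HZ T E b i = true) :
    (treeDecoder n HX.length T).CorrectsUpTo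
      (CSSCode.ofMatrices (Census.rowMatrix n HX) (Census.rowMatrix n HZ) hcomm).zSyndrome
      ((CSSCode.ofMatrices (Census.rowMatrix n HX) (Census.rowMatrix n HZ) hcomm).rowSpZ :
        Set (Fin n → ZMod 2)) hammingNorm (b + 1) :=
  correctsUpToX_of_radiusChunksTreeE
    (CSSCode.ofMatrices (Census.rowMatrix n HX) (Census.rowMatrix n HZ) hcomm).swap.comm h0 h

/-! ## Exactness one weight up, tree form -/

/-- **Failure witness check, tree form** (`X`-sector form; exchange the row lists for `Z`): the error word `e`
(`< 2^n`) has weight `≤ t + 1`, and the witness `u` is orthogonal to every STABILIZER row (`Census.synZero n Hstab u`)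
and has ODD overlap with the residual `T(s) ⊕ e`, `s` = the `Hsyn`-syndrome word of `e` (`synWordOf`). (definition) -/
noncomputable def checkFailTreeX (n : ℕ) (Hsyn Hstab : List ℕ) (T : Census.SynTree) (t e u : ℕ) : Bool :=
  (Census.popc n e).ble (t + 1) && (e < 2 ^ n : Bool) && Census.synZero n Hstab u &&
    (Census.popc n (u &&& (((T.find (synWordOf n Hsyn e)).getD 0) ^^^ e)) % 2 == 1)

/-- **Soundness of the tree failure witness**: the tree decoder does NOT correct every `X`-error of weight
`≤ t + 1` (the residual of the `X`-error `ofBits n e` is outside the row space of `H^X`,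
`not_mem_rowSpace_of_witness`). (theorem) -/
theorem not_correctsUpToX_of_checkFailTreeX {n : ℕ} {HX HZ : List ℕ}
    (hcomm : Census.rowMatrix n HX * (Census.rowMatrix n HZ)ᵀ = 0) {T : Census.SynTree} {t e u : ℕ}
    (h : checkFailTreeX n HZ HX T t e u = true) :
    ¬ (treeDecoder n HZ.length T).CorrectsUpTo
      (CSSCode.ofMatrices (Census.rowMatrix n HX) (Census.rowMatrix n HZ) hcomm).xSyndrome
      ((CSSCode.ofMatrices (Census.rowMatrix n HX) (Census.rowMatrix n HZ) hcomm).rowSpX :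
        Set (Fin n → ZMod 2)) hammingNorm (t + 1) := by
  simp only [checkFailTreeX, Bool.and_eq_true, Nat.ble_eq, decide_eq_true_eq, beq_iff_eq] at h
  obtain ⟨⟨⟨hwt, _⟩, hu⟩, hodd⟩ := h
  intro hD
  have hcorr := hD (Census.ofBits n e) (by rw [Census.hammingNorm_ofBits]; exact hwt)
  rw [Decoder.corrects_iff, SetLike.mem_coe] at hcorr
  refine not_mem_rowSpace_of_witness (Census.ofBits n u) ((Census.synZero_iff _ _ _).1 hu) ?_ hcorr
  rw [CSSCode.xSyndrome_apply, treeDecoder, toBits_mulVec_ofBits, ← Census.ofBits_xor,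
    Census.ofBits_dotProduct, Census.natCast_zmod2_ne_zero_iff]
  exact hodd

/-! ## A meet-in-the-middle distance certificate is a certified bounded-distance decoder -/

namespace DistCertRadius

open Census

/-- **(T1) inside a passed mitm replay is a route-I radius certificate.** For any word lists: a passed
`mitmLowerOK n Hsyn allow wmax wa wb pos T` contains `pos = posList n Hsyn` and the (T1) scan
`scan (tableTest T) pos wb 0 0`, i.e. `checkRadiusTreeI n Hsyn T wb`. (theorem) -/
theorem checkRadiusTreeI_of_mitmLowerOK {n : ℕ} {Hsyn allow : List ℕ} {wmax wa wb : ℕ} {pos : List (ℕ × ℕ)}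
    {T : SynTree} (h : mitmLowerOK n Hsyn allow wmax wa wb pos T = true) :
    checkRadiusTreeI n Hsyn T wb = true := by
  simp only [mitmLowerOK, Bool.and_eq_true, beq_iff_eq] at h
  obtain ⟨⟨⟨_, hpos⟩, hT1⟩, _⟩ := h
  subst hpos
  exact hT1

/-- **MITM ⇒ RADIUS, `X`-sector.** For a distance certificate `c` whose checks commute, a passed `X`-side
meet-in-the-middle replay `c.mitmX wa wb pos T = true` gives: the shipped table `T`, read as the tree decoder on the
`H^Z`-syndrome, corrects every `X`-error of weight `≤ wb` on `c.code` (residual in `rs H^X`; in fact residual `0`).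
Zero extra kernel cost: the hypothesis is the distance certificate's own lower-bound theorem. (theorem)
[cite: RyanLinWilson2024, §3.1.4 (table-look-up / bounded-distance decoding)] -/
theorem correctsUpToX_of_mitmX (c : DistCert) (hc : commOK c.n c.HX c.HZ = true) {wa wb : ℕ}
    {pos : List (ℕ × ℕ)} {T : SynTree} (h : c.mitmX wa wb pos T = true) :
    (treeDecoder c.n c.HZ.length T).CorrectsUpTo (c.code hc).xSyndrome
      ((c.code hc).rowSpX : Set (Fin c.n → ZMod 2)) hammingNorm wb :=
  correctsUpToX_of_checkRadiusTreeI _ (checkRadiusTreeI_of_mitmLowerOK h)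

/-- **MITM ⇒ RADIUS, `Z`-sector**: a passed `Z`-side replay `c.mitmZ wa wb pos T = true` gives: the tree decoder of
`T` on the `H^X`-syndrome corrects every `Z`-error of weight `≤ wb` on `c.code`. (theorem)
[cite: RyanLinWilson2024, §3.1.4 (table-look-up / bounded-distance decoding)] -/
theorem correctsUpToZ_of_mitmZ (c : DistCert) (hc : commOK c.n c.HX c.HZ = true) {wa wb : ℕ}
    {pos : List (ℕ × ℕ)} {T : SynTree} (h : c.mitmZ wa wb pos T = true) :
    (treeDecoder c.n c.HX.length T).CorrectsUpTo (c.code hc).zSyndrome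
      ((c.code hc).rowSpZ : Set (Fin c.n → ZMod 2)) hammingNorm wb :=
  correctsUpToZ_of_checkRadiusTreeI _ (checkRadiusTreeI_of_mitmLowerOK h)

end DistCertRadius

/-! ## Control (CERT-REQS A1): the `[[4,2,2]]` certificate's mitm tables as decoders of radius `0` -/

/-- On the `[[4,2,2]]` control certificate of `CertCheck.lean` (mitm replay `wmax = 1 = 1 + 0`, table `treeC422` =
the empty pattern only), the shipped table decodes every `X`-error of weight `≤ 0` — the pipeline end to end on the
smallest control, tier KERNEL (`decide` inside `Census.mitmX_certC422`). (theorem) -/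
theorem correctsUpToX_certC422_mitm :
    (treeDecoder Census.certC422.n Census.certC422.HZ.length Census.treeC422).CorrectsUpTo
      (Census.certC422.code (Census.certC422.commOK_of_checkStructure Census.checkStructure_certC422)).xSyndrome
      ((Census.certC422.code
          (Census.certC422.commOK_of_checkStructure Census.checkStructure_certC422)).rowSpX :
        Set (Fin Census.certC422.n → ZMod 2)) hammingNorm 0 :=
  DistCertRadius.correctsUpToX_of_mitmX Census.certC422 _ Census.mitmX_certC422

/-- The same on the `Z` side of the `[[4,2,2]]` control. (theorem) -/
theorem correctsUpToZ_certC422_mitm :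
    (treeDecoder Census.certC422.n Census.certC422.HX.length Census.treeC422).CorrectsUpTo
      (Census.certC422.code (Census.certC422.commOK_of_checkStructure Census.checkStructure_certC422)).zSyndrome
      ((Census.certC422.code
          (Census.certC422.commOK_of_checkStructure Census.checkStructure_certC422)).rowSpZ :
        Set (Fin Census.certC422.n → ZMod 2)) hammingNorm 0 :=
  DistCertRadius.correctsUpToZ_of_mitmZ Census.certC422 _ Census.mitmZ_certC422

end Summit.Ventures.QEC.Decoders
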